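import Summits.AtomisticToContinuum.HydrodynamicLimit.Theorems.JParityClosureOddContactSymmetryGibbsInvariance
import Summits.AtomisticToContinuum.HydrodynamicLimit.Theorems.OneFlightGossipEngineOneFlightLayeredChaosRegimes
import Summits.AtomisticToContinuum.HydrodynamicLimit.Theorems.OneFlightGossipEngineCollisionActivityTailsActivityDomination
import Literature.MathematicalPhysics.KineticTheory.PseudoTrajectoryComparisonData
import HarnessLib

/-!
# `CollisionActivityTails` (stmt-AtomisticToContinuum-13734), line `plaque-thinning-count-ld`, stub 4
# `stub_preShockEnvelope`: what is provable today — the EQUILIBRIUM rung of the pre-shock envelope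

The registered stub `stub_preShockEnvelope : PreShockEnvelope` is the line's IMPORT of the open crux
item stmt-AtomisticToContinuum-13677 (`Theses.BGEndpointRigidity.LanfordEnvelopeR`, N-uniform Gaussian
envelope of all bounded-order marginals along the NON-equilibrium evolution; bridge
`CollisionActivityTailsPlaqueSplit.preShockEnvelope_of_lanfordEnvelopeR`, landed). It is NOT proved here.

This work file records, sorry-free, the one special case that landed statics already give: CONSTANT
profiles `(a₀, 0, θ₀)` (global equilibrium). Then the canonical density `W_N` is invariant along every
hard-sphere flow on its good set (`Theorems.canonicalDensity_const_flow`, Liouville + energy/momentum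
conservation), the good set is Lebesgue-conull in the hard-sphere domain, so
`𝟙_D · (W_N ∘ Φ_{-r}) = W_N` a.e. and its marginals are a.e. those of `W_N`
(`nthMarginal_congr_ae`); and the static marginals of the hard-sphere Gibbs state obey
`W_N^{(k)} ≤ 2^k M_β^{⊗k}` in the regime `N (2ε_N)³ ≤ 1/2`, i.e. `8σ³ ≤ 1/2`
(`nthMarginal_canonicalDensity_le_two_pow`, BGSR 2016 Prop. 3.2 with (A.1)), with
`M_β^{⊗k} = c_β^k e^{-β E_k}` (`tensorPow_maxwellianBeta`). Hence the envelope with `β = θ₀⁻¹`,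
`C = 2 c_β`, for ALL `N`, all orders `k`, all flows and ALL times `r` (no horizon), `σ ≤ 1/4`.

References: T. Bodineau, I. Gallagher, L. Saint-Raymond, Invent. Math. 203 (2016), Prop. 3.2, 4.1 and
Appendix A; H. Spohn, *Large Scale Dynamics of Interacting Particles* (1991), Part I §2.3.
-/

noncomputable section

open MeasureTheory Set Filter Topology
open scoped ENNReal

namespace Summit.AtomisticToContinuum.HydrodynamicLimit.Theorems.CollisionActivityTailsPreShockEnvelope

open Literature.MathematicalPhysics.KineticTheory Literature.Analysis.FluidPDE
open Literature.Analysis.FunctionSpaces (maxwellianBeta)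
open Summit.AtomisticToContinuum.HydrodynamicLimit.Theorems.CollisionActivityTailsActivityDomination (Flow)
open Summit.AtomisticToContinuum.HydrodynamicLimit.Theorems.OLC (canonicalDensity_const_mul')

/-- The constant local Gibbs profile `(a₀, 0, θ₀)` is `a₀` times BGSR's Maxwellian `M_β`, `β = θ₀⁻¹`.
[folklore] -/
theorem localGibbsProfile_const_eq (a₀ θ₀ : ℝ) :
    localGibbsProfile (fun _ => a₀) (fun _ => 0) (fun _ => θ₀) =
      fun p : T3 × V3 => a₀ * maxwellianBeta θ₀⁻¹ p.2 := by
  funext p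
  simp [localGibbsProfile, maxwellianBeta, inv_inv]

/-- For constant profiles the canonical density is the hard-sphere Gibbs density of the Maxwellian
`M_{θ₀⁻¹}` (the activity cancels). [folklore] -/
theorem canonicalDensity_const_eq {a₀ : ℝ} (ha : a₀ ≠ 0) (θ₀ ε : ℝ) (n : ℕ) :
    canonicalDensity (Torus.geometry (Fin 3)) ε n (localGibbsProfile (fun _ => a₀) (fun _ => 0) (fun _ => θ₀)) =
      canonicalDensity (Torus.geometry (Fin 3)) ε n (fun p : T3 × V3 => maxwellianBeta θ₀⁻¹ p.2) := by
  rw [localGibbsProfile_const_eq, canonicalDensity_const_mul' _ _ _ _ ha]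

/-- **Stationarity, density form.** For constant profiles, `𝟙_D · (W_N ∘ Φ_{-r}) = W_N` Lebesgue-a.e.:
on the good set `W_N ∘ Φ_{-r} = W_N` (`canonicalDensity_const_flow`), off the hard-sphere domain both
sides vanish, and `D ∖ good` is Lebesgue-null (`HardSphereFlow.measure_compl_good`). [folklore] -/
theorem indicator_hsTransport_const_ae_eq (a₀ θ₀ : ℝ) (u : V3) {σ : ℝ} {N : ℕ} (Φ : Flow σ N) (r : ℝ) :
    (hardSphereDomain (Torus.geometry (Fin 3)) (N + 1) (hsDiameter σ N)).indicator
        (hsTransport Φ r (canonicalDensity (Torus.geometry (Fin 3)) (hsDiameter σ N) (N + 1)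
          (localGibbsProfile (fun _ => a₀) (fun _ => u) (fun _ => θ₀)))) =ᵐ[volume]
      canonicalDensity (Torus.geometry (Fin 3)) (hsDiameter σ N) (N + 1)
        (localGibbsProfile (fun _ => a₀) (fun _ => u) (fun _ => θ₀)) := by
  have hnull : ∀ᵐ z ∂(volume : Measure (Config (N + 1) (Fin 3) T3)),
      z ∉ Φ.goodᶜ ∩ hardSphereDomain (Torus.geometry (Fin 3)) (N + 1) (hsDiameter σ N) := by
    have h := Φ.measure_compl_good
    rw [liouville_eq, Measure.restrict_apply Φ.measurableSet_good.compl] at h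
    exact measure_eq_zero_iff_ae_notMem.1 h
  filter_upwards [hnull] with z hz
  by_cases hg : z ∈ Φ.good
  · rw [indicator_of_mem (Φ.good_subset hg), hsTransport_apply, canonicalDensity_const_flow a₀ θ₀ u Φ hg (-r)]
  · have hzD : z ∉ hardSphereDomain (Torus.geometry (Fin 3)) (N + 1) (hsDiameter σ N) := fun hD => hz ⟨hg, hD⟩
    rw [indicator_of_notMem hzD, canonicalDensity, indicator_of_notMem hzD, mul_zero]

/-- The dilution regime of BGSR Prop. 3.2 at fixed reduced density: `N (2 ε_N)³ ≤ 8σ³ ≤ 1/2` once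
`σ ≤ 1/4` (`(N+1) ε_N³ = σ³`). [folklore] -/
theorem regime_of_le_quarter {σ : ℝ} (hσ : 0 < σ) (hσ4 : σ ≤ 4⁻¹) (N : ℕ) :
    ((N + 1 - 1 : ℕ) : ℝ) * (2 * hsDiameter σ N) ^ Fintype.card (Fin 3) ≤ 2⁻¹ := by
  have hε : 0 ≤ hsDiameter σ N := (hsDiameter_pos hσ N).le
  have hcube := succ_mul_hsDiameter_pow_three σ N
  simp only [Nat.add_sub_cancel, Fintype.card_fin]
  have hN : (N : ℝ) ≤ ((N + 1 : ℕ) : ℝ) := by exact_mod_cast N.le_succ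
  have hε3 : 0 ≤ hsDiameter σ N ^ 3 := pow_nonneg hε 3
  have hσ3 : σ ^ 3 ≤ (4⁻¹ : ℝ) ^ 3 := pow_le_pow_left₀ hσ.le hσ4 3
  calc (N : ℝ) * (2 * hsDiameter σ N) ^ 3 = 8 * ((N : ℝ) * hsDiameter σ N ^ 3) := by ring
    _ ≤ 8 * (((N + 1 : ℕ) : ℝ) * hsDiameter σ N ^ 3) := by gcongr
    _ = 8 * σ ^ 3 := by rw [hcube]
    _ ≤ 8 * (4⁻¹ : ℝ) ^ 3 := by gcongr
    _ ≤ 2⁻¹ := by norm_num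

/-- **EQUILIBRIUM ENVELOPE (all times, all flows, all `N`).** For constant profiles `(a₀, 0, θ₀)`,
`a₀ > 0`, `θ₀ > 0`, and `0 < σ ≤ 1/4`: with `β = θ₀⁻¹` and `C = 2 c_β`, `c_β = (2πθ₀)^{-3/2}`, for every
`N`, every order `k`, every hard-sphere flow and every time `r`, for a.e. `Z_k` the `k`-marginal of
`𝟙_D · (W_N ∘ Φ_{-r})` is at most `C^k e^{-β E(Z_k)}` (BGSR 2016 Prop. 4.1 at `ρ⁰ ≡ 1`: maximum principle,
here plain invariance, plus Prop. 3.2). [cite: BodineauGallagherSaintRaymondInvent2016, Prop. 3.2, Prop. 4.1] -/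
theorem envelope_const {a₀ θ₀ : ℝ} (ha : 0 < a₀) (hθ : 0 < θ₀) {σ : ℝ} (hσ : 0 < σ) (hσ4 : σ ≤ 4⁻¹) :
    ∃ β C : ℝ, 0 < β ∧ ∀ (N k : ℕ) (Φ : Flow σ N) (r : ℝ),
      ∀ᵐ Zk : Config k (Fin 3) T3,
        |nthMarginal (N + 1) k ((hardSphereDomain (Torus.geometry (Fin 3)) (N + 1) (hsDiameter σ N)).indicator
            (hsTransport Φ r (canonicalDensity (Torus.geometry (Fin 3)) (hsDiameter σ N) (N + 1)
              (localGibbsProfile (fun _ => a₀) (fun _ => 0) (fun _ => θ₀))))) Zk|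
          ≤ C ^ k * Real.exp (-(β * configEnergy Zk)) := by
  set β : ℝ := θ₀⁻¹ with hβdef
  have hβ : 0 < β := inv_pos.2 hθ
  set c : ℝ := (2 * Real.pi * β⁻¹) ^ (-(Module.finrank ℝ (EuclideanSpace ℝ (Fin 3)) : ℝ) / 2) with hcdef
  have hc : 0 < c := Real.rpow_pos_of_pos (by positivity) _
  refine ⟨β, 2 * c, hβ, fun N k Φ r => ?_⟩
  have hae := Literature.MathematicalPhysics.KineticTheory.nthMarginal_congr_ae (s := k)
    (indicator_hsTransport_const_ae_eq a₀ θ₀ 0 Φ r)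
  filter_upwards [hae] with Zk hZk
  rw [hZk, canonicalDensity_const_eq ha.ne' θ₀]
  rcases le_or_gt k (N + 1) with hk | hk
  · have hnn : 0 ≤ nthMarginal (N + 1) k (canonicalDensity (Torus.geometry (Fin 3)) (hsDiameter σ N) (N + 1)
        (fun p : T3 × V3 => maxwellianBeta β p.2)) Zk :=
      nthMarginal_nonneg (N + 1) k (fun z => canonicalDensity_maxwellianBeta_nonneg hβ z) Zk
    rw [abs_of_nonneg hnn]
    refine (nthMarginal_canonicalDensity_le_two_pow hβ (hsDiameter_pos hσ N).le hk
      (regime_of_le_quarter hσ hσ4 N) Zk).trans (le_of_eq ?_)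
    rw [tensorPow_maxwellianBeta, mul_pow, neg_mul]
    ring
  · have h0 : nthMarginal (N + 1) k (canonicalDensity (Torus.geometry (Fin 3)) (hsDiameter σ N) (N + 1)
        (fun p : T3 × V3 => maxwellianBeta β p.2)) Zk = 0 := by
      simp [nthMarginal, not_le.2 hk]
    rw [h0, abs_zero]
    positivity

/-- **The equilibrium rung of `PreShockEnvelope`**: the body of `CollisionActivityTailsPlaqueSplit.PreShockEnvelope`
with the profiles instantiated at constants `(a₀, 0, θ₀)` holds (with `σ₀ = 1/4`, and `β, C` independent of
`t`, of the Euler solution and of the flows). [cite: BodineauGallagherSaintRaymondInvent2016, Prop. 3.2, Prop. 4.1] -/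
theorem preShockEnvelope_equilibrium (a₀ θ₀ : ℝ) (ha : 0 < a₀) (hθ : 0 < θ₀) :
    ∃ σ₀ : ℝ, 0 < σ₀ ∧ ∀ σ : ℝ, 0 < σ → σ < σ₀ →
    ∀ (T : ℝ) (ρ θ : ℝ → T3 → ℝ) (u : ℝ → T3 → V3), IsHardSphereEulerSolution σ T ρ u θ →
    ∀ Φ : (N : ℕ) → Flow σ N,
    TendstoHydroFieldsAt (fun N => localGibbsLaw σ (fun _ => a₀) (fun _ => 0) (fun _ => θ₀) N (Φ N)) Φ ρ u θ 0 →
    ∀ t ∈ Set.Ico 0 T, ∃ β C : ℝ, 0 < β ∧ ∀ (N : ℕ) (k : ℕ), ∀ r ∈ Set.Icc 0 t,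
      ∀ᵐ Zk : Config k (Fin 3) T3,
        |nthMarginal (N + 1) k ((hardSphereDomain (Torus.geometry (Fin 3)) (N + 1) (hsDiameter σ N)).indicator
            (hsTransport (Φ N) r (canonicalDensity (Torus.geometry (Fin 3)) (hsDiameter σ N) (N + 1)
              (localGibbsProfile (fun _ => a₀) (fun _ => 0) (fun _ => θ₀))))) Zk|
          ≤ C ^ k * Real.exp (-(β * configEnergy Zk)) := by
  refine ⟨4⁻¹, by norm_num, fun σ hσ hσlt T ρ θ u _ Φ _ t _ => ?_⟩
  obtain ⟨β, C, hβ, h⟩ := envelope_const ha hθ hσ hσlt.le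
  exact ⟨β, C, hβ, fun N k r _ => h N k (Φ N) r⟩

/-- **Registered helper sub-goal `stub_preShockEnvelopeEquilibrium`** (line `plaque-thinning-count-ld`, the EQUILIBRIUM RUNG
of the import stub 4 `PreShockEnvelope`): for constant profiles `(a₀, 0, θ₀)` and `0 < σ ≤ 1/4` the Gaussian envelope of all
bounded-order marginals of the transported canonical density holds for all `N`, all orders, all flows and ALL times
(`envelope_const`). [cite: BodineauGallagherSaintRaymondInvent2016, Prop. 3.2, Prop. 4.1] -/
theorem stub_preShockEnvelopeEquilibrium : ∀ (a₀ θ₀ : ℝ), 0 < a₀ → 0 < θ₀ → ∀ σ : ℝ, 0 < σ → σ ≤ 4⁻¹ → ∃ β C : ℝ, 0 < β ∧ ∀ (N k : ℕ) (Φ : Flow σ N) (r : ℝ), ∀ᵐ Zk : Config k (Fin 3) T3, |nthMarginal (N + 1) k ((hardSphereDomain (Torus.geometry (Fin 3)) (N + 1) (hsDiameter σ N)).indicator (hsTransport Φ r (canonicalDensity (Torus.geometry (Fin 3)) (hsDiameter σ N) (N + 1) (localGibbsProfile (fun _ => a₀) (fun _ => 0) (fun _ => θ₀))))) Zk| ≤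 C ^ k * Real.exp (-(β * configEnergy Zk)) :=
  fun _ _ ha hθ _ hσ hσ4 => envelope_const ha hθ hσ hσ4

/-- The equilibrium envelope, one instance at a time (corollary of `envelope_const`; appended, cycle 1 — also triggers the farm rebuild of this
module, whose olean was missing). [cite: BodineauGallagherSaintRaymondInvent2016, Prop. 3.2, Prop. 4.1] -/
theorem envelope_const_at {a₀ θ₀ : ℝ} (ha : 0 < a₀) (hθ : 0 < θ₀) {σ : ℝ} (hσ : 0 < σ) (hσ4 : σ ≤ 4⁻¹)
    (N k : ℕ) (Φ : Flow σ N) (r : ℝ) :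
    ∃ β C : ℝ, 0 < β ∧ ∀ᵐ Zk : Config k (Fin 3) T3,
      |nthMarginal (N + 1) k ((hardSphereDomain (Torus.geometry (Fin 3)) (N + 1) (hsDiameter σ N)).indicator
          (hsTransport Φ r (canonicalDensity (Torus.geometry (Fin 3)) (hsDiameter σ N) (N + 1)
            (localGibbsProfile (fun _ => a₀) (fun _ => 0) (fun _ => θ₀))))) Zk| ≤ C ^ k * Real.exp (-(β * configEnergy Zk)) := by
  obtain ⟨β, C, hβ, h⟩ := envelope_const ha hθ hσ hσ4
  exact ⟨β, C, hβ, h N k Φ r⟩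

end Summit.AtomisticToContinuum.HydrodynamicLimit.Theorems.CollisionActivityTailsPreShockEnvelope

end
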